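import Summits.BirchSwinnertonDyer.Rank1Residual.P2.CongruentNumberThetaCriterion
import HarnessLib
import HarnessLib.Audit.Tags

/-!
# Cell «bsd-monsky» (prover-B): the uniform Θ-criterion — the TWO-LEVEL Θ-certificate
# `s(n) = g(n) + Σ_{6-blocks d₀ ∈ R(n)} 𝓛(n/d₀)·g(d₀)`, `s(e) = g(e)` (valid whenever no proper `6`-block `e ∣ n` with `n/e ≡ 1 (mod 8)`
# has a `6`-block in its own `R(e)`), and the criterion in that shape (kernel lemmas; nothing asserted, nothing booked)

HONEST FRAMING (cell `bsd-monsky`, run/shared/lean/pub/bsd-monsky/; README §1/§3): part of the record «what the same argument gives at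
ℓ ≥ 3», in the kernel, relative to the Literature display `tyz_cmPointGaloisData` (nothing asserted; no count moves; NOT refereed).
`P2/CongruentNumberThetaCriterion.lean` proves `odd_scriptL_of_thetaCert` for an arbitrary Θ-certificate `s`. Every type done so far
(`k = 2`; `k = 3`: `(5,5,7)`, `(3,7,7)` [g8], `(3,5,5)`, `(1,5,7)`, `(1,3,5)`; `k = 4`: `(3,5,5,5)`) has Θ-DEPTH ≤ 2: the proper
`6`-blocks `e` with cofactor `n/e ≡ 1 (mod 8)` have no `6`-block in `R(e)`, so the certificate is the explicit two-level sum
`Θ(n) = g(n) + Σ_{d₀ ∈ R(n), d₀ ≡ 6} 𝓛(n/d₀)·g(d₀)`. THIS FILE packages that case once: `thetaCert_twoLevel` (the two-level function IS a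
certificate under the depth hypothesis), `odd_scriptL_of_twoLevel` and `analyticRank_eq_one_of_twoLevel_of_cmPointGaloisData` (the
criterion with the hypothesis «`g(n) + Σ 𝓛(n/d₀)g(d₀)` odd»). A consumer then only lists the `6`-blocks of `R(n)` and the parities.

References: [TianYuanZhang2017] §3.1 (p0011 L67–L73), Thm. 3.5, Thm. 3.6 (J741), proof of Lemma 3.21 (J759);
HOME/proof/PROOF-B-THETA-CRITERION.md §4.
-/

noncomputable section

open scoped Classical

open WeierstrassCurve WeierstrassCurve.Affine Literature.NumberTheory.EllipticCurves
  Literature.NumberTheory.EllipticCurves.Rank1Residual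
  Literature.NumberTheory.EllipticCurves.Rank1Residual.Typed
  Literature.NumberTheory.EllipticCurves.TianYuanZhang2017
  Literature.NumberTheory.EllipticCurves.TianYuanZhang2017.W2

set_option autoImplicit false

namespace Summit.BirchSwinnertonDyer.Rank1Residual.P2

namespace ThetaDescent

variable {n : ℕ}

/-- **The two-level Θ-certificate.** If no proper `6`-block `e ∣ n` with `n/e ≡ 1 (mod 8)` has a `6`-block in `R(e)`, then
`s(n) = g(n) + Σ_{d₀ ∈ R(n), d₀ ≡ 6} 𝓛(n/d₀)·g(d₀)`, `s(e) = g(e)` (`e ≠ n`) satisfies the certificate equations.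
[cite: TianYuanZhang2017, §3.1 (p0011 L67–L73)] -/
theorem thetaCert_twoLevel (D : GenusPointData n)
    (hlev : ∀ e ∈ n.divisors, e % 8 = 6 → (n / e) % 8 = 1 → e ≠ n →
      (recursionIndex e).filter (fun d₀ => d₀ % 8 = 6) = ∅) :
    ∀ e ∈ n.divisors, e % 8 = 6 → (n / e) % 8 = 1 →
      (fun e : ℕ => if e = n then (gK n : ZMod 2) +
          ∑ d₀ ∈ (recursionIndex n).filter (fun d₀ => d₀ % 8 = 6), (D.scriptL (n / d₀) : ZMod 2) * (gK d₀ : ZMod 2)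
        else (gK e : ZMod 2)) e =
        (gK e : ZMod 2) +
          ∑ d₀ ∈ (recursionIndex e).filter (fun d₀ => d₀ % 8 = 6), (D.scriptL (e / d₀) : ZMod 2) *
            (fun e : ℕ => if e = n then (gK n : ZMod 2) +
                ∑ d₀ ∈ (recursionIndex n).filter (fun d₀ => d₀ % 8 = 6), (D.scriptL (n / d₀) : ZMod 2) * (gK d₀ : ZMod 2)
              else (gK e : ZMod 2)) d₀ := by
  intro e he he6 hq1
  by_cases hen : e = n
  · subst hen
    simp only [if_true]
    congr 1
    refine Finset.sum_congr rfl fun d₀ hd₀ => ?_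
    rw [if_neg (lt_of_mem_recursionIndex (Finset.mem_filter.mp hd₀).1).ne]
  · simp only [if_neg hen, hlev e he he6 hq1 hen, Finset.sum_empty, add_zero]

/-- **The Θ-criterion for types of Θ-depth ≤ 2.** For square-free `θ`-controlled `n ≡ 6 (mod 8)` such that no proper `6`-block
`e ∣ n` with `n/e ≡ 1 (mod 8)` has a `6`-block in `R(e)`, TYZ data with the displayed sentences and rank `≤ 1` once `𝓛 ≠ 0`:
if `g(n) + Σ_{d₀ ∈ R(n), d₀ ≡ 6 (8)} 𝓛(n/d₀)·g(d₀)` is ODD then `𝓛(n)` is ODD.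
[cite: TianYuanZhang2017, Thm. 3.5 (p0011 L94–L112), Thm. 3.6 (2) (J741), §3.1 (p0011 L67–L73), proof of Lemma 3.21 (J759)] -/
theorem odd_scriptL_of_twoLevel (hsq : Squarefree n) (h6 : n % 8 = 6) (D : GenusPointData n) (hD : D.Printed)
    (hG : D.CMPointGaloisPrinted)
    (hr :
      letI := isElliptic_congruentNumberCurve hsq.ne_zero
      D.scriptL n ≠ 0 → (congruentNumberCurve n).mordellWeilRank ≤ 1)
    (hctrl : ∀ d₀ ∈ n.divisors, d₀ % 8 = 7 → (n / d₀) % 8 = 2 → ∀ d' ∈ d₀.divisors, d' % 8 = 5 →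
      ∀ p ∈ d'.primeFactors, p % 4 = 1)
    (hlev : ∀ e ∈ n.divisors, e % 8 = 6 → (n / e) % 8 = 1 → e ≠ n →
      (recursionIndex e).filter (fun d₀ => d₀ % 8 = 6) = ∅)
    (hΘ : (gK n : ZMod 2) +
      ∑ d₀ ∈ (recursionIndex n).filter (fun d₀ => d₀ % 8 = 6), (D.scriptL (n / d₀) : ZMod 2) * (gK d₀ : ZMod 2) = 1) :
    Odd (D.scriptL n) := by
  refine odd_scriptL_of_thetaCert hsq h6 D hD hG hr hctrl _ (thetaCert_twoLevel D hlev) ?_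
  simp only [if_true]
  exact hΘ

/-- **`𝓛(n) ≠ 0` in the two-level shape — NO rank input.** [cite: TianYuanZhang2017, Thm. 3.5 (p0011 L94–L95), Lemma 3.18] -/
theorem scriptL_ne_zero_of_twoLevel (hsq : Squarefree n) (h6 : n % 8 = 6) (D : GenusPointData n) (hD : D.Printed)
    (hG : D.CMPointGaloisPrinted)
    (hctrl : ∀ d₀ ∈ n.divisors, d₀ % 8 = 7 → (n / d₀) % 8 = 2 → ∀ d' ∈ d₀.divisors, d' % 8 = 5 →
      ∀ p ∈ d'.primeFactors, p % 4 = 1)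
    (hlev : ∀ e ∈ n.divisors, e % 8 = 6 → (n / e) % 8 = 1 → e ≠ n →
      (recursionIndex e).filter (fun d₀ => d₀ % 8 = 6) = ∅)
    (hΘ : (gK n : ZMod 2) +
      ∑ d₀ ∈ (recursionIndex n).filter (fun d₀ => d₀ % 8 = 6), (D.scriptL (n / d₀) : ZMod 2) * (gK d₀ : ZMod 2) = 1) :
    D.scriptL n ≠ 0 := by
  intro h0
  have h := odd_scriptL_of_twoLevel hsq h6 D hD hG (fun h => absurd h0 h) hctrl hlev hΘ
  rw [h0] at h
  exact (Int.not_odd_iff_even.mpr Even.zero) h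

/-- **Clause (a) in the two-level shape, from the display ALONE**: `ord_{s=1} L(E_n, s) = 1`. CONDITIONAL on `tyz_cmPointGaloisData`;
nothing asserted. [cite: TianYuanZhang2017, §1 (p0002 L46–L75), §3] -/
theorem analyticRank_eq_one_of_twoLevel_of_cmPointGaloisData (hCM : tyz_cmPointGaloisData) (hsq : Squarefree n) (h6 : n % 8 = 6)
    (hctrl : ∀ d₀ ∈ n.divisors, d₀ % 8 = 7 → (n / d₀) % 8 = 2 → ∀ d' ∈ d₀.divisors, d' % 8 = 5 →
      ∀ p ∈ d'.primeFactors, p % 4 = 1)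
    (hlev : ∀ e ∈ n.divisors, e % 8 = 6 → (n / e) % 8 = 1 → e ≠ n →
      (recursionIndex e).filter (fun d₀ => d₀ % 8 = 6) = ∅)
    (hΘ : ∀ D : GenusPointData n, D.Printed → D.CMPointGaloisPrinted → (gK n : ZMod 2) +
      ∑ d₀ ∈ (recursionIndex n).filter (fun d₀ => d₀ % 8 = 6), (D.scriptL (n / d₀) : ZMod 2) * (gK d₀ : ZMod 2) = 1) :
    (congruentNumberCurve n).analyticRank = 1 := by
  obtain ⟨D, hD, hG⟩ := hCM _ hsq (Or.inr (Or.inl h6))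
  have hL : IsScriptL _ (D.scriptL n) := hD.1 _ (Nat.mem_divisors_self _ hsq.ne_zero) (by omega)
  exact analyticRank_congruentNumberCurve_eq_one_of_isScriptL hsq (Or.inr (Or.inl h6)) hL
    (scriptL_ne_zero_of_twoLevel hsq h6 D hD hG hctrl hlev (hΘ D hD hG))

/-- **Output shape in the two-level form**: an ODD `L` with `L² = 𝓛(n)²`, relative to {`tyz_cmPointGaloisData`, GZK}. CONDITIONAL; nothing asserted.
[cite: TianYuanZhang2017, Thm. 3.5 and §3] -/
theorem exists_odd_isScriptL_of_twoLevel_of_cmPointGaloisData (hCM : tyz_cmPointGaloisData)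
    (hGZK : rank_eq_analyticRank_of_analyticRank_le_one) (hsq : Squarefree n) (h6 : n % 8 = 6)
    (hctrl : ∀ d₀ ∈ n.divisors, d₀ % 8 = 7 → (n / d₀) % 8 = 2 → ∀ d' ∈ d₀.divisors, d' % 8 = 5 →
      ∀ p ∈ d'.primeFactors, p % 4 = 1)
    (hlev : ∀ e ∈ n.divisors, e % 8 = 6 → (n / e) % 8 = 1 → e ≠ n →
      (recursionIndex e).filter (fun d₀ => d₀ % 8 = 6) = ∅)
    (hΘ : ∀ D : GenusPointData n, D.Printed → D.CMPointGaloisPrinted → (gK n : ZMod 2) +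
      ∑ d₀ ∈ (recursionIndex n).filter (fun d₀ => d₀ % 8 = 6), (D.scriptL (n / d₀) : ZMod 2) * (gK d₀ : ZMod 2) = 1) :
    ∃ L : ℤ, Odd L ∧ IsScriptL n L := by
  haveI := isElliptic_congruentNumberCurve hsq.ne_zero
  obtain ⟨D, hD, hG⟩ := hCM _ hsq (Or.inr (Or.inl h6))
  have hL : IsScriptL _ (D.scriptL n) := hD.1 _ (Nat.mem_divisors_self _ hsq.ne_zero) (by omega)
  refine ⟨_, odd_scriptL_of_twoLevel hsq h6 D hD hG (fun hL0 => ?_) hctrl hlev (hΘ D hD hG), hL⟩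
  have har := S4 hsq (Or.inr (Or.inl h6)) hL hL0
  rw [(hGZK (congruentNumberCurve n) har).1]; exact har

end ThetaDescent

end Summit.BirchSwinnertonDyer.Rank1Residual.P2

end
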